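import Literature.AlgebraicGeometry.PlaneCurves.PlaneCubicWeberNormalForm
import Literature.AlgebraicGeometry.PlaneCurves.HessePencilCharacteristicThreeWebNonsingular
import HarnessLib

/-!
# Remark 2.1 by Weber's route: a smooth cubic with two flexes has a Hesse form in characteristic `3` (Artebani–Dolgachev)

Topic `Literature/AlgebraicGeometry/PlaneCurves`, namespace `Literature.AlgebraicGeometry.PlaneCurves`.
Lane `lit-hodgefound`, seat `lit-hodgefound-p37`, row g21-#14; assembles `PlaneCubicWeberNormalForm`
(g21-#13: two flexes ⇒ `F ∘ M = xy(ax + by + cz) + dz³`, any characteristic),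
`HessePencilCharacteristicThreeWebNonsingular` (g21-#11: for `3 = 0` the web cubic is singular iff
`abcd = 0`) and `HessePencilCharacteristicThreeWebForm` (g21-#9: for `abcd ≠ 0`,
`web ∘ S = (d/c³)·E_t`, `t = c³/(abd)`).  Everything here is PROVED; no definition, no named fact.

Source — M. Artebani, I. Dolgachev, *The Hesse pencil of plane cubic curves*, Enseign. Math. (2) 55
(2009), §2 (standing assumption "`k` algebraically closed"), Remark 2.1 [`paper:arxiv-math_0611590`
p0005 L60–61], VERBATIM: "The proof of the existence of a Hesse equation for an elliptic curve `E`
over a field of characteristic 3 goes through if we assume that `E` is an ordinary elliptic curve with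
rational 3-torsion points.  We find equation (4) and check that it defines a nonsingular curve only if
`abc ≠ 0`.  By scaling the variables we may assume that `a = b = −1, c = 1`.  Next we use the variable
change `z = u + x + y` to transform the equation to the Hesse form".

## Statement proved

**`exists_bind₁_eq_smul_hesseE_of_two_flexes`**: over an algebraically closed field with `3 = 0`, a
ternary cubic form `F` all of whose points are regular and which has two distinct flexes `A, B` (the
"rational 3-torsion points": in characteristic `3` an ordinary curve has three flexes, a supersingular
one has one) satisfies `F ∘ M = κ·E_t` for some invertible `M`, `κ ≠ 0`, `t ≠ 0` — the printed route
(Weber frame, then Remark 2.1's scaling and `z = u + x + y`), as opposed to the `j`-invariant route of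
`HessePencilCharacteristicThreeCanonicalForm` (g21-#8).  The intermediate
`web_coefficients_ne_zero_of_forall_regular` is A–D's "(4) defines a nonsingular curve only if
`abc ≠ 0`" read contrapositively on the given smooth `F`.

## References
* [ArtebaniDolgachev2009] M. Artebani, I. Dolgachev, *The Hesse pencil of plane cubic curves*,
  Enseign. Math. (2) 55 (2009) 235–273, §2, Lemma 1 (proof) and Remark 2.1.
* [Gibson1998] C. G. Gibson, *Elementary Geometry of Algebraic Curves*, CUP 1998, Lemma 13.2.
-/

set_option autoImplicit false

open MvPolynomial Matrix
open Literature.AlgebraicGeometry.HyperbolicPolynomials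

namespace Literature.AlgebraicGeometry.PlaneCurves

universe u

/-- The member `E_t = X³ + Y³ + Z³ + t·XYZ` (local notation, no definition). -/
local notation3 "𝐄[" t "]" =>
  (X 0 ^ 3 + X 1 ^ 3 + X 2 ^ 3 + C t * (X 0 * X 1 * X 2) : MvPolynomial (Fin 3) _)

/-- The web cubic `F = xy(ax + by + cz) + dz³` (local notation, no definition). -/
local notation3 "𝐅[" a ", " b ", " c ", " d "]" =>
  (X 0 * X 1 * (C a * X 0 + C b * X 1 + C c * X 2) + C d * X 2 ^ 3 : MvPolynomial (Fin 3) _)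

/-- `S = [[−a⁻¹, 0, 0], [0, −b⁻¹, 0], [c⁻¹, c⁻¹, c⁻¹]]` (g21-#9; local notation). -/
local notation3 "𝐒[" a ", " b ", " c "]" =>
  (Matrix.of ![![-a⁻¹, 0, 0], ![0, -b⁻¹, 0], ![c⁻¹, c⁻¹, c⁻¹]] : Matrix (Fin 3) (Fin 3) _)

section CharThreeTwoFlexes

variable {K : Type u} [Field K] {F : MvPolynomial (Fin 3) K}

/-- **"(4) defines a nonsingular curve only if `abc ≠ 0`", on the given curve**: if `F ∘ M` is the web
cubic with `det M ≠ 0` and `F` has no singular point (`3 = 0`, `K = K̄`), then `abcd ≠ 0` — a singular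
point `q` of `F ∘ M` (g21-#11 `web_singular_iff_of_three_eq_zero`) would give the singular point `Mq`
of `F`. [cite: ArtebaniDolgachev2009, §2, Remark 2.1] [cite: Gibson1998, Lemma 13.2] -/
theorem web_coefficients_ne_zero_of_forall_regular [IsAlgClosed K] (h3 : (3 : K) = 0)
    (hreg : ∀ p : Fin 3 → K, p ≠ 0 → eval p F = 0 → (fun i => eval p (pderiv i F)) ≠ 0)
    {M : Matrix (Fin 3) (Fin 3) K} (hM : M.det ≠ 0) {a b c d : K}
    (hFM : bind₁ M.toMvPolynomial F = 𝐅[a, b, c, d]) : a * b * c * d ≠ 0 := by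
  intro habcd
  obtain ⟨q, hq0, hq, hgq⟩ := (web_singular_iff_of_three_eq_zero h3 a b c d).2 habcd
  rw [← hFM, eval_bind₁_toMvPolynomial] at hq
  rw [← hFM, grad_bind₁_toMvPolynomial_eq_zero_iff hM] at hgq
  refine hreg (M *ᵥ q) ?_ hq hgq
  intro h0
  apply hq0
  have := congrArg (fun w => M⁻¹ *ᵥ w) h0
  rwa [Matrix.mulVec_mulVec, Matrix.nonsing_inv_mul _ (isUnit_iff_ne_zero.2 hM), Matrix.one_mulVec,
    Matrix.mulVec_zero] at this

/-- **Artebani–Dolgachev, Remark 2.1 by the printed route (Weber's frame, `a = b = −1, c = 1`,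
`z = u + x + y`).**  Over an algebraically closed field with `3 = 0`: a ternary cubic form `F` with all
points regular and two distinct flexes `A, B` is projectively equivalent to a nonsingular member of
the Hesse pencil — `F ∘ M = κ·E_t`, `det M ≠ 0`, `κ ≠ 0`, `t ≠ 0`. [cite: ArtebaniDolgachev2009, §2,
Remark 2.1; Lemma 1 (proof, eq. (4))] -/
theorem exists_bind₁_eq_smul_hesseE_of_two_flexes [IsAlgClosed K] (h3 : (3 : K) = 0)
    (hF : F.IsHomogeneous 3)
    (hreg : ∀ p : Fin 3 → K, p ≠ 0 → eval p F = 0 → (fun i => eval p (pderiv i F)) ≠ 0)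
    {A B : Fin 3 → K} (hA0 : A ≠ 0) (hA : eval A F = 0)
    (hfA : ∀ v, (fun j => eval A (pderiv j F)) ⬝ᵥ v = 0 → LinearIndependent K ![A, v] →
      Polynomial.X ^ 3 ∣ linePoly F A v)
    (hB0 : B ≠ 0) (hB : eval B F = 0)
    (hfB : ∀ v, (fun j => eval B (pderiv j F)) ⬝ᵥ v = 0 → LinearIndependent K ![B, v] →
      Polynomial.X ^ 3 ∣ linePoly F B v)
    (hAB : LinearIndependent K ![A, B]) :
    ∃ (M : Matrix (Fin 3) (Fin 3) K) (κ t : K), M.det ≠ 0 ∧ κ ≠ 0 ∧ t ≠ 0 ∧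
      bind₁ M.toMvPolynomial F = κ • (𝐄[t] : MvPolynomial (Fin 3) K) := by
  obtain ⟨M₁, a, b, c, d, hM₁, -, -, hweb⟩ := exists_bind₁_eq_web_of_two_flexes hF hA hfA
    (fun _ hv hind => linePoly_ne_zero_of_forall_regular hF hreg hA0 hA hv hind) hB hfB
    (fun _ hv hind => linePoly_ne_zero_of_forall_regular hF hreg hB0 hB hv hind) hAB
  have habcd := web_coefficients_ne_zero_of_forall_regular h3 hreg hM₁ hweb
  have ha : a ≠ 0 := fun h => habcd (by rw [h]; ring)
  have hb : b ≠ 0 := fun h => habcd (by rw [h]; ring)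
  have hc : c ≠ 0 := fun h => habcd (by rw [h]; ring)
  have hd : d ≠ 0 := fun h => habcd (by rw [h]; ring)
  obtain ⟨hS, ht⟩ := web_bind₁_eq_smul_hesseE h3 ha hb hc hd
  refine ⟨M₁ * 𝐒[a, b, c], d * c⁻¹ ^ 3, c ^ 3 * (a * b * d)⁻¹, ?_,
    mul_ne_zero hd (pow_ne_zero 3 (inv_ne_zero hc)), ht, ?_⟩
  · rw [Matrix.det_mul]
    exact mul_ne_zero hM₁ (web_matrix_det ha hb hc (K := K)).2
  · rw [bind₁_toMvPolynomial_mul, hweb, hS]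

end CharThreeTwoFlexes

end Literature.AlgebraicGeometry.PlaneCurves
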